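import Mathlib.GroupTheory.Index
import Mathlib.GroupTheory.QuotientGroup.Basic
import Mathlib.LinearAlgebra.Dimension.Finrank
import Summits.Ventures.QEC.Census.TwoBlockSubgroupKernelDimension
import Summits.Ventures.QEC.Census.BB.TwoBlockKernelWeightCounterexample80
import Summits.Ventures.QEC.Census.BB.TwoBlockKernelWeightCounterexample80b
import HarnessLib

/-!
# Abelian two-block codes: when `dim (ker A ∩ ker B) = [G : H]`, the kernel code IS the coset code of `H` and `d(ker A ∩ ker B) = |H|`

Sequel of `Census/TwoBlockSubgroupKernelDimension.lean` (same setting: finite abelian `G`, `a, b ∈ 𝔽₂[G]`, a subgroup `H ≤ G`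
with `A·1_H = 0 = B·1_H`, `K = ker A ∩ ker B ⊇` the span of the `[G : H]` coset indicators, so `dim K ≥ [G : H]`).

* `mem_span_cosetIndicator_of_finrank_le` — if moreover `dim K ≤ [G : H]` (so `= [G:H]`: the rate is exactly `2[G:H]/n`), then
  `K` is EXACTLY the span of the coset indicators (every `e ∈ K` is constant on the cosets of `H`);
* `apply_eq_apply_add_of_mem_span_cosetIndicator` — functions in that span are `H`-periodic;
* `card_le_hammingNorm_of_periodic` — a non-zero `H`-periodic function has weight `≥ |H|`;
* **`card_le_hammingNorm_of_mem_kerInter`** — hence, under `dim K = [G:H]`: every non-zero `e ∈ K` has `|e| ≥ |H|`, while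
  `|1_H| = |H|` (`hammingNorm_indH`): the minimum weight of `K ∖ 0` is `|H|` exactly.
* Application (`QC80_*`): for the `[[80, 20, 8]]` code `QC80` on `ℤ₂ × ℤ₂₀` of `Census/BB/TwoBlockKernelWeightCounterexample80.lean`
  (`dim K = 10 = [G : H]`, `H = ℤ₂ × 10ℤ₂₀ ≅ ℤ₂ × ℤ₂`): every non-zero `e ∈ ker A ∩ ker B` has `|e| ≥ 4`, `1_H` attains `4`, and
  `d = 8 = 2 · 4` — **`QC80_d_eq_two_mul_minWeight_kerInter`**: the distance is exactly twice the kernel weight (KERNEL; this makes the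
  «d = 2·d(K)» clause of the cell's X-2 record literal).
* Application 2 (`QC80b_*`, appended): for the `[[80, 10, 10]]` code `QC80b` of `Census/BB/TwoBlockKernelWeightCounterexample80b.lean`
  (`dim K = 5 = [G : H]`, `H = H80b = ℤ₂ × 5ℤ₂₀ ≅ ℤ₂ × ℤ₄`: `|H80b| = 8`, exponent 4, NOT cyclic — `not_isAddCyclic_H80b`): every non-zero
  `e ∈ ker A ∩ ker B` has `|e| ≥ 8 = |1_H|`, and `d = 10 > 8` — **`QC80b_d_gt_minWeight_kerInter`** (the X-2 bound `d ≤ |H|`, a theorem for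
  cyclic Sylow-2, fails for the subgroup type `ℤ₂ × ℤ₄`; KERNEL).

HONEST FRAMING: elementary linear algebra of ours (no printed statement formalized or contradicted); all proved, axioms standard, 0 kit.
-/

namespace Summit.Ventures.QEC.TwoBlockCyclicKernel

open Matrix Literature.InformationTheory.QuantumCodes Literature.InformationTheory.QuantumCodes.AbelianTwoBlock

variable {G : Type*} [AddCommGroup G] [Fintype G] [DecidableEq G]

/-- Each coset indicator lies in `ker A ∩ ker B` when `A·1_H = B·1_H = 0`. -/
theorem cosetIndicator_mem_kerInter (H : AddSubgroup G) [DecidablePred (· ∈ H)] {a b : G → ZMod 2}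
    (ha : circulant a *ᵥ indH H = 0) (hb : circulant b *ᵥ indH H = 0) (q : G ⧸ H) :
    cosetIndicator H q ∈ LinearMap.ker (circulant a).mulVecLin ⊓ LinearMap.ker (circulant b).mulVecLin := by
  obtain ⟨g, rfl⟩ := QuotientAddGroup.mk_surjective q
  rw [← conv_indH_single]
  exact conv_indH_mem_kerInter H ha hb _

omit [DecidableEq G] in
/-- The span of the coset indicators has dimension `[G : H]`. -/
theorem finrank_span_cosetIndicator (H : AddSubgroup G) :
    Module.finrank (ZMod 2) (Submodule.span (ZMod 2) (Set.range (cosetIndicator H))) = H.index := by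
  classical
  haveI : Fintype (G ⧸ H) := Fintype.ofFinite _
  rw [finrank_span_eq_card (cosetIndicator_linearIndependent H), AddSubgroup.index, Nat.card_eq_fintype_card]

/-- **`K` is the coset code.**  If `A·1_H = B·1_H = 0` and `dim (ker A ∩ ker B) ≤ [G : H]`, then every `e ∈ ker A ∩ ker B` lies in the
span of the coset indicators of `H`. -/
theorem mem_span_cosetIndicator_of_finrank_le (H : AddSubgroup G) [DecidablePred (· ∈ H)] {a b : G → ZMod 2}
    (ha : circulant a *ᵥ indH H = 0) (hb : circulant b *ᵥ indH H = 0)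
    (hdim : Module.finrank (ZMod 2) ↥(LinearMap.ker (circulant a).mulVecLin ⊓ LinearMap.ker (circulant b).mulVecLin) ≤ H.index)
    {e : G → ZMod 2} (he : e ∈ LinearMap.ker (circulant a).mulVecLin ⊓ LinearMap.ker (circulant b).mulVecLin) :
    e ∈ Submodule.span (ZMod 2) (Set.range (cosetIndicator H)) := by
  set K := LinearMap.ker (circulant a).mulVecLin ⊓ LinearMap.ker (circulant b).mulVecLin with hK
  have hle : Submodule.span (ZMod 2) (Set.range (cosetIndicator H)) ≤ K := by
    rw [Submodule.span_le]
    rintro _ ⟨q, rfl⟩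
    exact cosetIndicator_mem_kerInter H ha hb q
  have heq : Submodule.span (ZMod 2) (Set.range (cosetIndicator H)) = K := by
    apply Submodule.eq_of_le_of_finrank_le hle
    rw [finrank_span_cosetIndicator]
    exact hdim
  rw [heq]
  exact he

omit [Fintype G] [DecidableEq G] in
/-- Functions in the span of the coset indicators are constant on the cosets of `H`. -/
theorem apply_eq_apply_add_of_mem_span_cosetIndicator (H : AddSubgroup G) {e : G → ZMod 2}
    (he : e ∈ Submodule.span (ZMod 2) (Set.range (cosetIndicator H))) (u : G) {h : G} (hh : h ∈ H) :
    e (u + h) = e u := by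
  classical
  induction he using Submodule.span_induction with
  | mem x hx =>
    obtain ⟨q, rfl⟩ := hx
    have hq : (QuotientAddGroup.mk (u + h) : G ⧸ H) = QuotientAddGroup.mk u :=
      QuotientAddGroup.eq.mpr (by rw [neg_add_rev, add_assoc, neg_add_cancel, add_zero]; exact H.neg_mem hh)
    simp only [cosetIndicator, hq]
  | zero => rfl
  | add x y _ _ hx hy => simp only [Pi.add_apply, hx, hy]
  | smul c x _ hx => simp only [Pi.smul_apply, hx]

omit [DecidableEq G] in
/-- A non-zero `H`-periodic function has weight `≥ |H|`: its support contains a whole coset. -/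
theorem card_le_hammingNorm_of_periodic (H : AddSubgroup G) {e : G → ZMod 2}
    (hper : ∀ u : G, ∀ h ∈ H, e (u + h) = e u) (hne : e ≠ 0) : Nat.card H ≤ hammingNorm e := by
  classical
  obtain ⟨u, hu⟩ : ∃ u, e u ≠ 0 := Function.ne_iff.mp hne
  unfold hammingNorm
  let emb : H ↪ G := ⟨fun h : H => u + (h : G), fun x y hxy => Subtype.ext (add_left_cancel hxy)⟩
  rw [Nat.card_eq_fintype_card, ← Finset.card_univ, ← Finset.card_map emb]
  apply Finset.card_le_card
  intro g hg
  simp only [Finset.mem_map, Finset.mem_univ, true_and] at hg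
  obtain ⟨h, rfl⟩ := hg
  simp only [Finset.mem_filter, Finset.mem_univ, true_and]
  show e (u + (h : G)) ≠ 0
  rw [hper u h h.2]
  exact hu

omit [DecidableEq G] in
/-- `|1_H| = |H|`. -/
theorem hammingNorm_indH (H : AddSubgroup G) [DecidablePred (· ∈ H)] : hammingNorm (indH H) = Nat.card H := by
  classical
  unfold hammingNorm
  have hset : (Finset.univ.filter fun g : G => indH H g ≠ 0) = Finset.univ.filter (fun g : G => g ∈ H) := by
    ext g
    simp only [Finset.mem_filter, Finset.mem_univ, true_and, indH]
    by_cases hg : g ∈ H <;> simp [hg]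
  rw [hset, ← Fintype.card_subtype, Nat.card_eq_fintype_card]

/-- **`d(ker A ∩ ker B) ≥ |H|` when `dim (ker A ∩ ker B) = [G : H]`.**  If `A·1_H = B·1_H = 0` and `dim (ker A ∩ ker B) ≤ [G : H]`,
every non-zero `e ∈ ker A ∩ ker B` has weight `≥ |H|` (and `1_H ∈ ker A ∩ ker B` has weight `|H|`, `hammingNorm_indH`). -/
theorem card_le_hammingNorm_of_mem_kerInter (H : AddSubgroup G) [DecidablePred (· ∈ H)] {a b : G → ZMod 2}
    (ha : circulant a *ᵥ indH H = 0) (hb : circulant b *ᵥ indH H = 0)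
    (hdim : Module.finrank (ZMod 2) ↥(LinearMap.ker (circulant a).mulVecLin ⊓ LinearMap.ker (circulant b).mulVecLin) ≤ H.index)
    {e : G → ZMod 2} (he : e ∈ LinearMap.ker (circulant a).mulVecLin ⊓ LinearMap.ker (circulant b).mulVecLin) (hne : e ≠ 0) :
    Nat.card H ≤ hammingNorm e :=
  card_le_hammingNorm_of_periodic H
    (fun u _ hh => apply_eq_apply_add_of_mem_span_cosetIndicator H (mem_span_cosetIndicator_of_finrank_le H ha hb hdim he) u hh)
    hne

end Summit.Ventures.QEC.TwoBlockCyclicKernel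

/-! ## Application: `QC80` on `ℤ₂ × ℤ₂₀` — `d = 8 = 2 · d(ker A ∩ ker B)` literally -/

namespace Summit.Ventures.QEC.Census.TwoBlockKernelWeight

open Matrix Literature.InformationTheory.QuantumCodes Summit.Ventures.QEC.TwoBlockCyclicKernel

/-- The subgroup `H = ℤ₂ × 10ℤ₂₀ = {g : g.2 ∈ {0, 10}}` of `ℤ₂ × ℤ₂₀`, as the kernel of `g ↦ 2 • g.2` (membership decidable by
`AddMonoidHom.decidableMemKer` through the `abbrev`). (definition) -/
abbrev H80 : AddSubgroup (BB.Mono 2 20) :=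
  (AddMonoidHom.mul (2 : Fin 20) |>.comp (AddMonoidHom.snd (Fin 2) (Fin 20))).ker

/-- Membership in `H80`: `g ∈ H ↔ g.2 = 0 ∨ g.2 = 10`. -/
theorem mem_H80_iff (g : BB.Mono 2 20) : g ∈ H80 ↔ (g.2 = 0 ∨ g.2 = 10) := by
  change 2 * g.2 = 0 ↔ _
  rcases g with ⟨g1, g2⟩
  revert g1 g2
  decide

/-- `indH H80 = eH80` (the file's explicit indicator). -/
theorem indH_H80 : indH H80 = eH80 := by
  funext g
  simp only [indH, eH80, mem_H80_iff]

/-- `|H80| = 4`. -/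
theorem card_H80 : Nat.card H80 = 4 := by
  rw [← hammingNorm_indH, indH_H80, hammingNorm_eH80]

/-- `[ℤ₂ × ℤ₂₀ : H80] = 10`. -/
theorem index_H80 : H80.index = 10 := by
  have h := H80.card_mul_index
  rw [card_H80, Nat.card_eq_fintype_card] at h
  have hG : Fintype.card (BB.Mono 2 20) = 40 := by decide
  omega

/-- **Every non-zero `e ∈ ker A ∩ ker B` of `QC80` has weight `≥ 4`** (`K` = the span of the 10 coset indicators of `H80`). -/
theorem QC80_four_le_hammingNorm_of_mem_kerInter {e : BB.Mono 2 20 → ZMod 2} (he : e ∈ QC80.kerInter) (hne : e ≠ 0) :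
    4 ≤ hammingNorm e := by
  rw [← card_H80]
  have ha : circulant (BB.coeffVec QC80.A) *ᵥ indH H80 = 0 := by rw [indH_H80]; exact circulant_A_mulVec_eH80
  have hb : circulant (BB.coeffVec QC80.B) *ᵥ indH H80 = 0 := by rw [indH_H80]; exact circulant_B_mulVec_eH80
  refine card_le_hammingNorm_of_mem_kerInter H80 ha hb ?_ he hne
  rw [index_H80]
  exact le_of_eq QC80_finrank_kerInter

/-- **`d(QC80) = 8 = 2 · d(ker A ∩ ker B)`, literally**: the minimum weight of `ker A ∩ ker B ∖ 0` is `4` (attained by `1_H`, and a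
lower bound for every non-zero element), and `d = 2 · 4`. KERNEL. -/
theorem QC80_d_eq_two_mul_minWeight_kerInter :
    (∃ e ∈ QC80.kerInter, e ≠ 0 ∧ hammingNorm e = 4) ∧ (∀ e ∈ QC80.kerInter, e ≠ 0 → 4 ≤ hammingNorm e) ∧ QC80.d = 2 * 4 :=
  ⟨⟨eH80, eH80_mem_kerInter, eH80_ne_zero, hammingNorm_eH80⟩, fun _ he hne => QC80_four_le_hammingNorm_of_mem_kerInter he hne,
    QC80_d⟩

end Summit.Ventures.QEC.Census.TwoBlockKernelWeight

/-! ## Application 2: `QC80b` on `ℤ₂ × ℤ₂₀` (`Census/BB/TwoBlockKernelWeightCounterexample80b.lean`) — `H ≅ ℤ₂ × ℤ₄`, `d = 10 > 8 = d(K) = |H|` -/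

namespace Summit.Ventures.QEC.Census.TwoBlockKernelWeight

open Matrix Literature.InformationTheory.QuantumCodes Summit.Ventures.QEC.TwoBlockCyclicKernel

/-- The subgroup `H = ℤ₂ × 5ℤ₂₀ = {g : g.2 ∈ {0, 5, 10, 15}}` of `ℤ₂ × ℤ₂₀`, as the kernel of `g ↦ 4 • g.2` (membership decidable through
the `abbrev`). (definition) -/
abbrev H80b : AddSubgroup (BB.Mono 2 20) :=
  (AddMonoidHom.mul (4 : Fin 20) |>.comp (AddMonoidHom.snd (Fin 2) (Fin 20))).ker

/-- Membership in `H80b`: `g ∈ H ↔ g.2 ∈ {0, 5, 10, 15}`. -/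
theorem mem_H80b_iff (g : BB.Mono 2 20) : g ∈ H80b ↔ (g.2 = 0 ∨ g.2 = 5 ∨ g.2 = 10 ∨ g.2 = 15) := by
  change 4 * g.2 = 0 ↔ _
  rcases g with ⟨g1, g2⟩
  revert g1 g2
  decide

/-- `indH H80b = eH80b` (the instance file's explicit indicator). -/
theorem indH_H80b : indH H80b = eH80b := by
  funext g
  simp only [indH, eH80b, mem_H80b_iff]

/-- `|H80b| = 8`. -/
theorem card_H80b : Nat.card H80b = 8 := by
  rw [← hammingNorm_indH, indH_H80b, hammingNorm_eH80b]

/-- `[ℤ₂ × ℤ₂₀ : H80b] = 5`. -/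
theorem index_H80b : H80b.index = 5 := by
  have h := H80b.card_mul_index
  rw [card_H80b, Nat.card_eq_fintype_card] at h
  have hG : Fintype.card (BB.Mono 2 20) = 40 := by decide
  omega

/-- `H80b` has exponent `4`: `4 • g = 0` for every `g ∈ H80b` … -/
theorem four_nsmul_eq_zero_of_mem_H80b : ∀ g ∈ H80b, 4 • g = 0 := by
  decide

/-- … but not exponent `2`: `(0, 5) ∈ H80b` has `2 • (0, 5) ≠ 0`. So `H80b` (abelian of order 8, exponent 4) is `≅ ℤ₂ × ℤ₄`. -/
theorem exists_mem_H80b_two_nsmul_ne_zero : ∃ g ∈ H80b, 2 • g ≠ 0 :=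
  ⟨((0 : Fin 2), (5 : Fin 20)), by decide, by decide⟩

/-- `H80b` is NOT cyclic (a cyclic group of order 8 has an element of order 8, but `4 • g = 0` on `H80b`): the cyclic-Sylow-2 theorem
`css_dZ_le_of_indicator_comp_mem_ker` (`Census/TwoBlockCyclicSylowKernel.lean`) does not apply to `H80b`. -/
theorem not_isAddCyclic_H80b : ¬ IsAddCyclic H80b := by
  intro hc
  obtain ⟨g, hg⟩ := hc.exists_ofOrder_eq_natCard
  rw [card_H80b] at hg
  have h4 : 4 • g = 0 := Subtype.ext (four_nsmul_eq_zero_of_mem_H80b g.1 g.2)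
  have hdvd : addOrderOf g ∣ 4 := addOrderOf_dvd_of_nsmul_eq_zero h4
  rw [hg] at hdvd
  omega

/-- **Every non-zero `e ∈ ker A ∩ ker B` of `QC80b` has weight `≥ 8`** (`K` = the span of the 5 coset indicators of `H80b`). -/
theorem QC80b_eight_le_hammingNorm_of_mem_kerInter {e : BB.Mono 2 20 → ZMod 2} (he : e ∈ QC80b.kerInter) (hne : e ≠ 0) :
    8 ≤ hammingNorm e := by
  rw [← card_H80b]
  have ha : circulant (BB.coeffVec QC80b.A) *ᵥ indH H80b = 0 := by rw [indH_H80b]; exact circulant_A_mulVec_eH80b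
  have hb : circulant (BB.coeffVec QC80b.B) *ᵥ indH H80b = 0 := by rw [indH_H80b]; exact circulant_B_mulVec_eH80b
  refine card_le_hammingNorm_of_mem_kerInter H80b ha hb ?_ he hne
  rw [index_H80b]
  exact le_of_eq QC80b_finrank_kerInter

/-- **`QC80b`: `d = 10 > 8 = d(ker A ∩ ker B) = |H|` with `H ≅ ℤ₂ × ℤ₄` non-cyclic, literally**: the minimum weight of `ker A ∩ ker B ∖ 0`
is `8` (attained by `1_H`, a lower bound for every non-zero element), `|H| = 8`, `H` is not cyclic, and `d = 10`. KERNEL. -/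
theorem QC80b_d_gt_minWeight_kerInter :
    (∃ e ∈ QC80b.kerInter, e ≠ 0 ∧ hammingNorm e = 8) ∧ (∀ e ∈ QC80b.kerInter, e ≠ 0 → 8 ≤ hammingNorm e) ∧
      indH H80b ∈ QC80b.kerInter ∧ Nat.card H80b = 8 ∧ ¬ IsAddCyclic H80b ∧ QC80b.d = 10 :=
  ⟨⟨eH80b, eH80b_mem_kerInter, eH80b_ne_zero, hammingNorm_eH80b⟩, fun _ he hne => QC80b_eight_le_hammingNorm_of_mem_kerInter he hne,
    indH_H80b ▸ eH80b_mem_kerInter, card_H80b, not_isAddCyclic_H80b, QC80b_d⟩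

end Summit.Ventures.QEC.Census.TwoBlockKernelWeight
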